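import Literature.NumberTheory.LFunctions.Zhang2022.DHMenuConsistentRow04High
import Literature.NumberTheory.LFunctions.Zhang2022.DHMenuConsistentRow04
import Literature.NumberTheory.LFunctions.Zhang2022.DHMenuConsistentFence
import HarnessLib

/-!
# B-DH-W row dhE-04, the WORLD HALF below `Re = ½`: the crude count facts `hlow`, `hlowX` of
# `Zhang2022.DH.row04_of_counts` for the (A)-world `W(D, χ)`, and row04 ASSEMBLED for the world
# (cell `landau-siegel`, §E theorem `menuConsistent_holds`; ls-Bdh-typer-1, 2026-08-26T20:4xZ)

Topic `Literature/NumberTheory/LFunctions/Zhang2022` (namespace `Literature.NumberTheory.LFunctions.Zhang2022.DH`). For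
`w := world D χ` and every `Q ≥ 3`, `σ : ℝ`: `N_W(σ, Q) ≤ Q⁴` and `N*_W(σ, Q) ≤ Q⁴` (`world_zeroCount_le_pow_four`,
`world_zeroCountExcl_le_pow_four`), in exactly the binder shapes `hlow` / `hlowX` of ls-barrier-p1's `row04_of_counts`;
whence **`world_row04`**: the field `Menu.row04` for the world (`row04_of_counts` fed with these two and the four
high-`σ` facts of `DHMenuConsistentRow04High`).

Counting (no analysis beyond ls-barrier-p4's `DHMenuConsistentFence`): the fence of conductor `f ≥ 1` below height
`T ≥ 0` lies in the two images of `range (fenceCount f T)` (`fenceOrdinate_le_iff_le_count`), so it is finite with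
`≤ 2·fenceCount f T` points (`fence_box_finite`, `fence_box_ncard_le`); a slot's zero box is inside that set `∪ {β₁, 1 − β₁}`
(`world_zeroBox_subset`), so `#box ≤ 2·fenceCount + 2`, and the box count (multiplicities `≤ 1`, `mult_world_le_one`) is at
most that (`world_charZeroCountRe_le`, `world_charZeroCountReExcl_le`); `2·fenceCount f Q + 2 ≤ F_f(Q) + 3 ≤
(2/3)Q(Q − 1) + 3 ≤ Q²` for `1 ≤ f ≤ Q`, `Q ≥ 3` (`log x ≤ x − 1`, `π > 3`; `two_fenceCount_add_two_le`); there are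
`φ(i+1) ≤ i+1 ≤ ⌊Q⌋` characters of level `i + 1` (`DirichletCharacter.card_eq_totient_of_hasEnoughRootsOfUnity`) and `⌊Q⌋`
levels, so `N_W(σ, Q) ≤ ⌊Q⌋²·Q² ≤ Q⁴`.

WHAT THIS IS NOT: no statement about any actual `L`-function; `world_row04` is ONE field of the B-dh KILL target on the
(A)-world. «The programme SEARCHES and TYPES; no claim about Landau–Siegel zeros, Theorems 1–2 of arXiv:2211.02515 or a
repaired Margin232 until a kernel theorem says so.»

## References

* `B-dh/SIGMA-E-HANDOVER.md` v1.1 (row04); ls-barrier-plan 20:05:01Z (b); `DHMenuConsistentRow04.lean` (p1).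
* [ThornerZaman2024LogFree] Thm. 1.2 / Cor. 6.1; [BennettMartinOBryantRechnitzer2021] Thm. 1.1 (the fence main term).
-/

noncomputable section

open scoped Classical
open Complex

namespace Literature.NumberTheory.LFunctions.Zhang2022.DH

section Row04Low

variable {D : ℕ} {χ : DirichletCharacter ℂ D}

/-! ### The fence below a height is finite, with at most `2·fenceCount` points -/

/-- The fence of conductor `f ≥ 1` below height `T ≥ 0` lies in the two images of `range (fenceCount f T)`.
[cite: BennettMartinOBryantRechnitzer2021, Theorem 1.1] -/
theorem fence_box_subset {f : ℕ} (hf : 1 ≤ f) {T : ℝ} (hT : 0 ≤ T) :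
    fence f ∩ {ρ | |ρ.im| ≤ T} ⊆
      ((fun n : ℕ => (1 / 2 : ℂ) + ((fenceOrdinate f (n + 1) : ℝ) : ℂ) * I) '' ↑(Finset.range (fenceCount f T))) ∪
      ((fun n : ℕ => (1 / 2 : ℂ) - ((fenceOrdinate f (n + 1) : ℝ) : ℂ) * I) '' ↑(Finset.range (fenceCount f T))) := by
  rintro ρ ⟨hρ, hT'⟩
  have hn1 : ∀ n : ℕ, 1 ≤ n + 1 := fun n => Nat.succ_le_succ (Nat.zero_le n)
  have hpos : ∀ n : ℕ, 0 ≤ fenceOrdinate f (n + 1) := fun n => (fenceOrdinate_pos hf (hn1 n)).le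
  rcases mem_fence_iff.1 hρ with ⟨n, rfl⟩ | ⟨n, rfl⟩
  · left
    refine ⟨n, ?_, rfl⟩
    have him : |((1 / 2 : ℂ) + ((fenceOrdinate f (n + 1) : ℝ) : ℂ) * I).im| = fenceOrdinate f (n + 1) := by
      simp [abs_of_nonneg (hpos n)]
    have h1 : fenceOrdinate f (n + 1) ≤ T := by rw [← him]; exact hT'
    have h2 := (fenceOrdinate_le_iff_le_count hf (hn1 n) hT).1 h1
    simp only [Finset.coe_range, Set.mem_Iio]
    omega
  · right
    refine ⟨n, ?_, rfl⟩
    have him : |((1 / 2 : ℂ) - ((fenceOrdinate f (n + 1) : ℝ) : ℂ) * I).im| = fenceOrdinate f (n + 1) := by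
      simp [abs_of_nonneg (hpos n)]
    have h1 : fenceOrdinate f (n + 1) ≤ T := by rw [← him]; exact hT'
    have h2 := (fenceOrdinate_le_iff_le_count hf (hn1 n) hT).1 h1
    simp only [Finset.coe_range, Set.mem_Iio]
    omega

/-- The fence below a height is FINITE. [cite: BennettMartinOBryantRechnitzer2021, Theorem 1.1] -/
theorem fence_box_finite {f : ℕ} (hf : 1 ≤ f) {T : ℝ} (hT : 0 ≤ T) : (fence f ∩ {ρ | |ρ.im| ≤ T}).Finite :=
  (((Finset.finite_toSet _).image _).union ((Finset.finite_toSet _).image _)).subset (fence_box_subset hf hT)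

/-- The fence below height `T` has at most `2·fenceCount f T` points. [cite: BennettMartinOBryantRechnitzer2021, Theorem 1.1] -/
theorem fence_box_ncard_le {f : ℕ} (hf : 1 ≤ f) {T : ℝ} (hT : 0 ≤ T) :
    (fence f ∩ {ρ | |ρ.im| ≤ T}).ncard ≤ 2 * fenceCount f T := by
  have hA := (Finset.finite_toSet (Finset.range (fenceCount f T))).image
    (fun n : ℕ => (1 / 2 : ℂ) + ((fenceOrdinate f (n + 1) : ℝ) : ℂ) * I)
  have hB := (Finset.finite_toSet (Finset.range (fenceCount f T))).image
    (fun n : ℕ => (1 / 2 : ℂ) - ((fenceOrdinate f (n + 1) : ℝ) : ℂ) * I)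
  calc (fence f ∩ {ρ | |ρ.im| ≤ T}).ncard
      ≤ _ := Set.ncard_le_ncard (fence_box_subset hf hT) (hA.union hB)
    _ ≤ _ := Set.ncard_union_le _ _
    _ ≤ (Finset.range (fenceCount f T) : Set ℕ).ncard + (Finset.range (fenceCount f T) : Set ℕ).ncard :=
        add_le_add (Set.ncard_image_le (Finset.finite_toSet _)) (Set.ncard_image_le (Finset.finite_toSet _))
    _ = 2 * fenceCount f T := by rw [Set.ncard_coe_finset, Finset.card_range]; ring

/-! ### A slot's zero box -/

/-- The zero box of a slot lies in (fence of the conductor below the height) `∪ {β₁, 1 − β₁}`.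
[cite: Zhang2022LandauSiegel, §2 Assumption (A)] -/
theorem world_zeroBox_subset {q : ℕ} (ψ : DirichletCharacter ℂ q) (σ T : ℝ) :
    (world D χ).zeroSetRe q ψ σ T ⊆ (fence ψ.conductor ∩ {ρ | |ρ.im| ≤ T}) ∪ excPair D := by
  rintro ρ ⟨hz, -, hT⟩
  rw [isZero_world_iff] at hz
  rcases hz with hf | ⟨-, hp⟩
  · exact Or.inl ⟨hf, hT⟩
  · exact Or.inr hp

/-- The exceptional pair is finite … [cite: Zhang2022LandauSiegel, §2 Assumption (A)] -/
theorem excPair_finite : (excPair D).Finite := by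
  unfold excPair
  exact (Set.finite_singleton _).insert _

/-- … with at most two points. [cite: Zhang2022LandauSiegel, §2 Assumption (A)] -/
theorem excPair_ncard_le : (excPair D).ncard ≤ 2 := by
  unfold excPair
  exact (Set.ncard_insert_le _ _).trans (by rw [Set.ncard_singleton])

/-- A slot's zero box below a height is finite (conductor `≥ 1`). [cite: ThornerZaman2024LogFree, §1 (1.2)] -/
theorem world_zeroBox_finite {q : ℕ} (ψ : DirichletCharacter ℂ q) (hc : 1 ≤ ψ.conductor) (σ : ℝ) {T : ℝ}
    (hT : 0 ≤ T) : ((world D χ).zeroSetRe q ψ σ T).Finite :=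
  ((fence_box_finite hc hT).union excPair_finite).subset (world_zeroBox_subset ψ σ T)

/-- A slot's zero box below a height has at most `2·fenceCount (cond ψ) T + 2` points. [cite: ThornerZaman2024LogFree, §1 (1.2)] -/
theorem world_zeroBox_ncard_le {q : ℕ} (ψ : DirichletCharacter ℂ q) (hc : 1 ≤ ψ.conductor) (σ : ℝ) {T : ℝ}
    (hT : 0 ≤ T) : ((world D χ).zeroSetRe q ψ σ T).ncard ≤ 2 * fenceCount ψ.conductor T + 2 :=
  calc ((world D χ).zeroSetRe q ψ σ T).ncard
      ≤ _ := Set.ncard_le_ncard (world_zeroBox_subset ψ σ T) ((fence_box_finite hc hT).union excPair_finite)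
    _ ≤ _ := Set.ncard_union_le _ _
    _ ≤ 2 * fenceCount ψ.conductor T + 2 := add_le_add (fence_box_ncard_le hc hT) excPair_ncard_le

/-- The box count of a slot (multiplicities `≤ 1`) is at most `2·fenceCount (cond ψ) T + 2`.
[cite: ThornerZaman2024LogFree, §1 (1.2)] -/
theorem world_charZeroCountRe_le {q : ℕ} [NeZero q] (ψ : DirichletCharacter ℂ q) (σ : ℝ) {T : ℝ} (hT : 0 ≤ T) :
    (world D χ).charZeroCountRe q ψ σ T ≤ 2 * fenceCount ψ.conductor T + 2 := by
  have hc : 1 ≤ ψ.conductor := Nat.one_le_iff_ne_zero.mpr (DirichletCharacter.conductor_ne_zero ψ)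
  have hfin := world_zeroBox_finite (D := D) (χ := χ) ψ hc σ hT
  unfold ZeroWorld.charZeroCountRe
  rw [finsum_mem_eq_finite_toFinset_sum _ hfin]
  calc ∑ ρ ∈ hfin.toFinset, (world D χ).mult q ψ ρ ≤ ∑ ρ ∈ hfin.toFinset, 1 :=
        Finset.sum_le_sum (fun ρ _ => mult_world_le_one χ ψ ρ)
    _ = ((world D χ).zeroSetRe q ψ σ T).ncard := by simp [Set.ncard_eq_toFinset_card _ hfin]
    _ ≤ _ := world_zeroBox_ncard_le ψ hc σ hT

/-- The same for the box with one point removed (the `N*` count). [cite: ThornerZaman2024LogFree, §1 (1.2)] -/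
theorem world_charZeroCountReExcl_le {q : ℕ} [NeZero q] (ψ : DirichletCharacter ℂ q) (σ : ℝ) {T : ℝ} (hT : 0 ≤ T)
    (b : ℂ) : ∑ᶠ ρ ∈ (world D χ).zeroSetRe q ψ σ T \ {b}, (world D χ).mult q ψ ρ ≤ 2 * fenceCount ψ.conductor T + 2 := by
  have hc : 1 ≤ ψ.conductor := Nat.one_le_iff_ne_zero.mpr (DirichletCharacter.conductor_ne_zero ψ)
  have hfin0 := world_zeroBox_finite (D := D) (χ := χ) ψ hc σ hT
  have hfin : ((world D χ).zeroSetRe q ψ σ T \ {b}).Finite := hfin0.subset Set.sdiff_subset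
  rw [finsum_mem_eq_finite_toFinset_sum _ hfin]
  calc ∑ ρ ∈ hfin.toFinset, (world D χ).mult q ψ ρ ≤ ∑ ρ ∈ hfin.toFinset, 1 :=
        Finset.sum_le_sum (fun ρ _ => mult_world_le_one χ ψ ρ)
    _ = ((world D χ).zeroSetRe q ψ σ T \ {b}).ncard := by simp [Set.ncard_eq_toFinset_card _ hfin]
    _ ≤ ((world D χ).zeroSetRe q ψ σ T).ncard := Set.ncard_le_ncard Set.sdiff_subset hfin0
    _ ≤ _ := world_zeroBox_ncard_le ψ hc σ hT

/-! ### The crude numerical bound `2·fenceCount f Q + 2 ≤ Q²` for `1 ≤ f ≤ Q`, `Q ≥ 3` -/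

/-- `2·fenceCount f Q + 2 ≤ F_f(Q) + 3 ≤ (2/3)Q(Q − 1) + 3 ≤ Q²` (`log x ≤ x − 1`, `π > 3`).
[cite: BennettMartinOBryantRechnitzer2021, Theorem 1.1] -/
theorem two_fenceCount_add_two_le {f : ℕ} (hf : 1 ≤ f) {Q : ℝ} (hQ : 3 ≤ Q) (hfQ : (f : ℝ) ≤ Q) :
    2 * (fenceCount f Q : ℝ) + 2 ≤ Q ^ 2 := by
  have hf1 : (1 : ℝ) ≤ f := by exact_mod_cast hf
  have hQ0 : 0 < Q := by linarith
  -- `F_f(Q) ≤ (2/3) Q (Q - 1)`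
  have hF : rvmMain f Q ≤ 2 / 3 * Q * (Q - 1) := by
    unfold rvmMain
    have hx : 0 < (f : ℝ) * Q / (2 * Real.pi * Real.exp 1) := by positivity
    have hx2 : (f : ℝ) * Q / (2 * Real.pi * Real.exp 1) ≤ Q ^ 2 := by
      rw [div_le_iff₀ (by positivity)]
      have h1 : (1 : ℝ) ≤ 2 * Real.pi * Real.exp 1 := by
        have := Real.pi_gt_three
        have := Real.add_one_le_exp (1 : ℝ)
        nlinarith
      nlinarith
    have hlog : Real.log ((f : ℝ) * Q / (2 * Real.pi * Real.exp 1)) ≤ 2 * (Q - 1) := by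
      calc Real.log ((f : ℝ) * Q / (2 * Real.pi * Real.exp 1)) ≤ Real.log (Q ^ 2) := Real.log_le_log hx hx2
        _ = 2 * Real.log Q := by rw [Real.log_pow]; push_cast; ring
        _ ≤ 2 * (Q - 1) := by linarith [Real.log_le_sub_one_of_pos hQ0]
    have hpi : Q / Real.pi ≤ Q / 3 := div_le_div_of_nonneg_left hQ0.le (by norm_num) Real.pi_gt_three.le
    have hQpi : 0 ≤ Q / Real.pi := by positivity
    calc Q / Real.pi * Real.log ((f : ℝ) * Q / (2 * Real.pi * Real.exp 1)) ≤ Q / Real.pi * (2 * (Q - 1)) :=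
          mul_le_mul_of_nonneg_left hlog hQpi
      _ ≤ Q / 3 * (2 * (Q - 1)) := mul_le_mul_of_nonneg_right hpi (by linarith)
      _ = 2 / 3 * Q * (Q - 1) := by ring
  -- `fenceCount ≤ (F + 1)/2` or `= 0`
  unfold fenceCount
  by_cases hx : 0 ≤ (rvmMain f Q + 1) / 2
  · have hfl : (⌊(rvmMain f Q + 1) / 2⌋₊ : ℝ) ≤ (rvmMain f Q + 1) / 2 := Nat.floor_le hx
    nlinarith
  · rw [Nat.floor_of_nonpos (le_of_lt (not_le.mp hx))]
    push_cast
    nlinarith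

/-! ### `hlow` / `hlowX` for the world -/

/-- Per primitive-slot term of `N_W(σ, Q)`: at most `Q²` (level `i + 1 ≤ ⌊Q⌋`). [cite: ThornerZaman2024LogFree, Theorem 1.2] -/
theorem world_term_le_sq {Q : ℝ} (hQ : 3 ≤ Q) {i : ℕ} (hi : i ∈ Finset.range ⌊Q⌋₊)
    (ψ : DirichletCharacter ℂ (i + 1)) (σ : ℝ) :
    ((world D χ).charZeroCountRe (i + 1) ψ σ Q : ℝ) ≤ Q ^ 2 ∧
      ((∑ᶠ ρ ∈ (world D χ).zeroSetRe (i + 1) ψ σ Q \ {(((world D χ).betaOne Q : ℝ) : ℂ)},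
          (world D χ).mult (i + 1) ψ ρ : ℕ) : ℝ) ≤ Q ^ 2 := by
  haveI : NeZero (i + 1) := ⟨Nat.succ_ne_zero i⟩
  have hQ0 : 0 ≤ Q := by linarith
  have hc : 1 ≤ ψ.conductor := Nat.one_le_iff_ne_zero.mpr (DirichletCharacter.conductor_ne_zero ψ)
  have hcQ : (ψ.conductor : ℝ) ≤ Q := by
    have h1 : ψ.conductor ≤ i + 1 := Nat.le_of_dvd (Nat.succ_pos i) ψ.conductor_dvd_level
    have h2 : i + 1 ≤ ⌊Q⌋₊ := Finset.mem_range.mp hi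
    exact le_trans (by exact_mod_cast h1.trans h2) (Nat.floor_le hQ0)
  have hB := two_fenceCount_add_two_le hc hQ hcQ
  constructor
  · have h := world_charZeroCountRe_le (D := D) (χ := χ) ψ σ hQ0
    calc ((world D χ).charZeroCountRe (i + 1) ψ σ Q : ℝ) ≤ ((2 * fenceCount ψ.conductor Q + 2 : ℕ) : ℝ) := by
          exact_mod_cast h
      _ ≤ Q ^ 2 := by push_cast; exact hB
  · have h := world_charZeroCountReExcl_le (D := D) (χ := χ) ψ σ hQ0 (((world D χ).betaOne Q : ℝ) : ℂ)
    calc _ ≤ ((2 * fenceCount ψ.conductor Q + 2 : ℕ) : ℝ) := by exact_mod_cast h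
      _ ≤ Q ^ 2 := by push_cast; exact hB

/-- The double-sum bookkeeping: if every term is `≤ Q²`, the family sum is `≤ Q⁴`. [cite: ThornerZaman2024LogFree, Theorem 1.2] -/
theorem family_sum_le_pow_four {Q : ℝ} (hQ : 3 ≤ Q) (t : (i : ℕ) → DirichletCharacter ℂ (i + 1) → ℕ)
    (ht : ∀ i ∈ Finset.range ⌊Q⌋₊, ∀ ψ : DirichletCharacter ℂ (i + 1), (t i ψ : ℝ) ≤ Q ^ 2) :
    ((∑ i ∈ Finset.range ⌊Q⌋₊, ∑ ψ : DirichletCharacter ℂ (i + 1), t i ψ : ℕ) : ℝ) ≤ Q ^ 4 := by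
  have hQ0 : 0 ≤ Q := by linarith
  have hN : (⌊Q⌋₊ : ℝ) ≤ Q := Nat.floor_le hQ0
  push_cast
  have hinner : ∀ i ∈ Finset.range ⌊Q⌋₊,
      (∑ ψ : DirichletCharacter ℂ (i + 1), (t i ψ : ℝ)) ≤ (⌊Q⌋₊ : ℝ) * Q ^ 2 := by
    intro i hi
    haveI : NeZero (i + 1) := ⟨Nat.succ_ne_zero i⟩
    have hcard : (Fintype.card (DirichletCharacter ℂ (i + 1)) : ℝ) ≤ ⌊Q⌋₊ := by
      -- `#DirichletCharacter ℂ (i+1) = φ(i+1) ≤ i+1` (also `LogFreeDensity.card_dirichletCharacter_le`, not imported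
      -- here to keep this module's closure small)
      have h1 : Fintype.card (DirichletCharacter ℂ (i + 1)) ≤ i + 1 := by
        rw [← Nat.card_eq_fintype_card, DirichletCharacter.card_eq_totient_of_hasEnoughRootsOfUnity ℂ (i + 1)]
        exact Nat.totient_le _
      have h2 : i + 1 ≤ ⌊Q⌋₊ := Finset.mem_range.mp hi
      exact_mod_cast h1.trans h2
    calc (∑ ψ : DirichletCharacter ℂ (i + 1), (t i ψ : ℝ)) ≤ ∑ _ψ : DirichletCharacter ℂ (i + 1), Q ^ 2 :=
          Finset.sum_le_sum (fun ψ _ => ht i hi ψ)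
      _ = (Fintype.card (DirichletCharacter ℂ (i + 1)) : ℝ) * Q ^ 2 := by
          rw [Finset.sum_const, nsmul_eq_mul, Finset.card_univ]
      _ ≤ (⌊Q⌋₊ : ℝ) * Q ^ 2 := mul_le_mul_of_nonneg_right hcard (by positivity)
  calc (∑ i ∈ Finset.range ⌊Q⌋₊, ∑ ψ : DirichletCharacter ℂ (i + 1), (t i ψ : ℝ))
      ≤ ∑ _i ∈ Finset.range ⌊Q⌋₊, (⌊Q⌋₊ : ℝ) * Q ^ 2 := Finset.sum_le_sum hinner
    _ = (⌊Q⌋₊ : ℝ) * ((⌊Q⌋₊ : ℝ) * Q ^ 2) := by rw [Finset.sum_const, nsmul_eq_mul, Finset.card_range]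
    _ ≤ Q * (Q * Q ^ 2) := by
        have h0 : (0 : ℝ) ≤ ⌊Q⌋₊ := Nat.cast_nonneg _
        nlinarith [mul_le_mul hN hN h0 hQ0]
    _ = Q ^ 4 := by ring

/-- **`hlow` for the world**: `N_W(σ, Q) ≤ Q⁴` for `Q ≥ 3`, any `σ`. [cite: ThornerZaman2024LogFree, Theorem 1.2] -/
theorem world_zeroCount_le_pow_four : ∀ Q σ : ℝ, 3 ≤ Q → ((world D χ).zeroCount σ Q : ℝ) ≤ Q ^ 4 := by
  intro Q σ hQ
  unfold ZeroWorld.zeroCount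
  refine family_sum_le_pow_four hQ _ (fun i hi ψ => ?_)
  split_ifs
  · exact (world_term_le_sq hQ hi ψ σ).1
  · push_cast; positivity

/-- **`hlowX` for the world**: `N*_W(σ, Q) ≤ Q⁴` for `Q ≥ 3`, any `σ`. [cite: ThornerZaman2024LogFree, Theorem 1.2] -/
theorem world_zeroCountExcl_le_pow_four : ∀ Q σ : ℝ, 3 ≤ Q → ((world D χ).zeroCountExcl σ Q : ℝ) ≤ Q ^ 4 := by
  intro Q σ hQ
  unfold ZeroWorld.zeroCountExcl
  refine family_sum_le_pow_four hQ _ (fun i hi ψ => ?_)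
  split_ifs
  · exact (world_term_le_sq hQ hi ψ σ).2
  · push_cast; positivity

/-! ### Row dhE-04 assembled for the world -/

/-- **Row dhE-04 on the world (Thorner–Zaman Thm. 1.2 ∧ Cor. 6.1, the four count bounds)** = ls-barrier-p1's
`row04_of_counts` fed with the world's count facts: above `Re = ½` at most the exceptional zero (`…Row04High`), below
it at most `Q⁴` zeros (this file), `β₁(Q) ∈ {0} ∪ [1 − (2/3)(log Q)⁻²⁰²², 1]`. [cite: ThornerZaman2024LogFree, Theorem 1.2] -/
theorem world_row04 (hL : (43250 : ℝ) ≤ Real.log D) (hprim : χ.IsPrimitive) :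
    (∀ Q : ℝ, 3 ≤ Q → ∀ σ : ℝ, 39 / 40 ≤ σ →
      ((world D χ).zeroCount σ Q : ℝ) ≤ 10 ^ 88 * (10 ^ 421 * Q ^ 99) ^ (1 - σ) ∧
        ((world D χ).zeroCountExcl σ Q : ℝ) ≤
          10 ^ 93 * min 1 ((1 - (world D χ).betaOne Q) * Real.log Q) * (10 ^ 466 * Q ^ 170) ^ (1 - σ)) ∧
    (∀ Q : ℝ, 3 ≤ Q → ∀ σ : ℝ, 0 ≤ σ →
      ((world D χ).zeroCount σ Q : ℝ) ≤ 10 ^ 88 * (10 ^ 421 * Q ^ 127) ^ (1 - σ) ∧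
        ((world D χ).zeroCountExcl σ Q : ℝ) ≤
          10 ^ 93 * min 1 ((1 - (world D χ).betaOne Q) * Real.log Q) * (10 ^ 466 * Q ^ 198) ^ (1 - σ)) :=
  row04_of_counts (world D χ) (world_zeroCount_eq_zero_of_one_le hL) (world_zeroCount_le_one_of_half_le hL hprim)
    (world_zeroCountExcl_eq_zero_of_half_le hL hprim) world_zeroCount_le_pow_four world_zeroCountExcl_le_pow_four
    (world_betaOne_dichotomy hL hprim)

end Row04Low

end Literature.NumberTheory.LFunctions.Zhang2022.DH

end
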